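import Summits.ValiantsHypothesis.ValiantsHypothesis.Theorems.KPlusLogSqLawValuativeDoorLeadsNat
import Summits.ValiantsHypothesis.ValiantsHypothesis.Theorems.KPlusLogSqLawValuativeDoorPathPencil
import Summits.ValiantsHypothesis.ValiantsHypothesis.Theorems.KPlusLogSqLawValuativeDoorRankOneLawToMDR
import Summits.ValiantsHypothesis.ValiantsHypothesis.Theorems.KPlusLogSqLawValuativeDoorSymmetryVoid
import Summits.ValiantsHypothesis.ValiantsHypothesis.Theorems.KPlusLogSqLawValuativeDoorTwoAdicOnReals

/-!
# LINE `valuative_door` (crux `WeakLifting`, stmt-ValiantsHypothesis-19561) — lane `…RankOneLawFalse`, file 3/3: the skeleton's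
# `ValRankOneLaw` and `ValRankOneSharp` AS TYPED (repeated letter exponents allowed) are FALSE

HONEST FRAMING.  Helper (cell `pub-symmetroid`, seat val-sym-lift-p1 g22, 2026-08-29; `--supports 19561 --as helper`).  KERNEL REFUTATION of two
candidate statements of `Cruxes/WeakLifting/Lines/valuative_door.lean` (V5: `stub_valRankOneLaw`; V6 removes the stub — class MISSTATED; the
repaired statement C′ = `ValRankOneSharpInj` is the theorem `valRankOneSharpInj_unfolded`, p706528), written out def-free:
`not_valRankOneLaw_unfolded : ¬ ValRankOneLaw` and `not_valRankOneSharp_unfolded : ¬ ValRankOneSharp`.  Paper source: pen val-idea-24 g4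
(2026-08-29T07:34Z, Carstensen / Gajjar–Radhakrishnan read-once embedding), critic VERDICT #64 concurring.  PROOF (assembled from kernel
pieces): suppose `npEdges ≤ (mK)^C` for all rank-one lacunary pencils over all non-archimedean fields of characteristic zero.  (a)
UNIVERSALITY (`…RankOneLawToMDR.genValRootLaw_of_valRankOneLaw_unfolded`): then every SYMMETRIC `(m, K)` pencil obeys `(m·(K·m))^C`;
(b) SYMMETRY IS VOID (`…SymmetryVoid.symmetryVoid_unfolded`, p700868): then every GENERAL `(k, K)` matrix pencil obeys
`B = (2k·(K·2k))^C`; (c) the 2-adic place on `ℝ` (`…TwoAdicOnReals.twoAdicOnReals_unfolded`, p701887) makes `F = ℝ` admissible; (d) the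
Gajjar–Radhakrishnan DAG with natural weights and `n^m` strict leaders (`exists_paramDAG_strictLeads_nat`, file 1/3) has a path polynomial
with `≥ n^m` dominant exponents (`le_card_dominant_pathPoly`, file 2/3) which IS the determinant of a general `(k, K)` pencil with
`k + 1 ≤ 3^m(1 + mn) + 1`, `K ≤ (k+1)² + 1` (`det_hessNeg_labels`, `exists_pencil_eq_hessNeg`); (e) arithmetic: with `m = 4C + 1`,
`X = 3^{m+1}(m+1)`, `n = 8^C X^{4C} + 2` one has `B + 2 ≤ n^m`, contradiction.  `ValRankOneSharp` implies `ValRankOneLaw` with `C = 1`.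
This refutes ONLY the two statements as typed (repeated exponents = general symmetric pencils of unbounded rank letters); it says nothing
about vW / vB (format-level laws with the `2^{C(K+log²m)}` budget and a tropical hypothesis), `WeakLifting` 19561, `MatrixDescartes` 18050
or VP ≠ VNP, all OPEN.  [Carstensen 1983 / Mulmuley–Shah 2001 / Gajjar–Radhakrishnan 2019 via the tree; elementary assembly]
-/

set_option linter.dupNamespace false
set_option autoImplicit false

namespace Summit.ValiantsHypothesis.ValiantsHypothesis.Theorems.KPlusLogSqLaw.ValDoor

open Polynomial Finset Matrix
open scoped BigOperators Classical
open Literature.Combinatorics.Optimization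
open Literature.Combinatorics.Optimization.ParamDAG
open Literature.Computability.AlgebraicComplexity (hessNeg)

/-! ## §1 Arithmetic of the parameters -/

/-- the size bookkeeping: with `m = 4C + 1`, `X = 3^{m+1}(m+1)`, `n = 8^C X^{4C} + 2`, `k + 1 ≤ 3^m (1 + m n) + 1`, `K ≤ (k+1)² + 1`,
the polynomial budget `(2k·(K·2k))^C` is at most `n^m − 2`. [bookkeeping] -/
theorem budget_lt (C k K : ℕ) (hk : k + 1 ≤ 3 ^ (4 * C + 1) * (1 + (4 * C + 1) * (8 ^ C * (3 ^ (4 * C + 2) * (4 * C + 2)) ^ (4 * C) + 2)) + 1)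
    (hK : K ≤ (k + 1) ^ 2 + 1) :
    (2 * k * (K * (2 * k))) ^ C + 2 ≤ (8 ^ C * (3 ^ (4 * C + 2) * (4 * C + 2)) ^ (4 * C) + 2) ^ (4 * C + 1) := by
  set m : ℕ := 4 * C + 1 with hm
  set X : ℕ := 3 ^ (4 * C + 2) * (4 * C + 2) with hX
  set n : ℕ := 8 ^ C * X ^ (4 * C) + 2 with hn
  set V : ℕ := k + 1 with hV
  have hn1 : 1 ≤ n := by rw [hn]; omega
  have hV1 : 1 ≤ V := by rw [hV]; omega
  -- V ≤ X n
  have hVX : V ≤ X * n := by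
    have h1 : 1 + m * n ≤ (m + 1) * n := by nlinarith
    have h3 : 1 ≤ 3 ^ m * ((m + 1) * n) := Nat.one_le_iff_ne_zero.2 (Nat.mul_ne_zero (pow_ne_zero _ (by norm_num)) (by nlinarith))
    calc V ≤ 3 ^ m * (1 + m * n) + 1 := hk
      _ ≤ 3 ^ m * ((m + 1) * n) + 3 ^ m * ((m + 1) * n) := Nat.add_le_add (Nat.mul_le_mul_left _ h1) h3
      _ ≤ 3 * (3 ^ m * ((m + 1) * n)) := by omega
      _ = X * n := by rw [hX, hm, pow_succ]; ring
  -- the budget base ≤ 8 V⁴ ≤ 8 (X n)^4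
  have hbase : 2 * k * (K * (2 * k)) ≤ 8 * (X * n) ^ 4 := by
    have hkV : k ≤ V := by rw [hV]; omega
    have hK2 : K ≤ 2 * V ^ 2 := by nlinarith
    calc 2 * k * (K * (2 * k)) = 4 * (k * k) * K := by ring
      _ ≤ 4 * (V * V) * (2 * V ^ 2) := Nat.mul_le_mul (Nat.mul_le_mul_left 4 (Nat.mul_le_mul hkV hkV)) hK2
      _ = 8 * V ^ 4 := by ring
      _ ≤ 8 * (X * n) ^ 4 := Nat.mul_le_mul_left 8 (Nat.pow_le_pow_left hVX 4)
  have hB : (2 * k * (K * (2 * k))) ^ C ≤ 8 ^ C * X ^ (4 * C) * n ^ (4 * C) :=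
    calc (2 * k * (K * (2 * k))) ^ C ≤ (8 * (X * n) ^ 4) ^ C := Nat.pow_le_pow_left hbase C
      _ = 8 ^ C * X ^ (4 * C) * n ^ (4 * C) := by rw [mul_pow, mul_pow, mul_pow, ← pow_mul, ← pow_mul, mul_assoc]
  -- n^m = n · n^{4C} = (8^C X^{4C} + 2) n^{4C}
  have hnm : n ^ m = (8 ^ C * X ^ (4 * C) + 2) * n ^ (4 * C) := by
    rw [hm, pow_succ, mul_comm, hn]
  have h1 : 1 ≤ n ^ (4 * C) := Nat.one_le_pow _ _ (by omega)
  rw [hnm]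
  nlinarith [hB, h1]

/-! ## §2 The refutations -/

/-- **`ValRankOneLaw` AS TYPED IS FALSE**: there is no `C` such that every rank-one lacunary pencil `Σ_l X^{d_l} ε_l u_l u_lᵀ` (repeated
exponents allowed) over every non-archimedean field of characteristic zero has `npEdges ≤ (mK)^C` (skeleton currency, unfolded). -/
theorem not_valRankOneLaw_unfolded :
    ¬ ∃ Cst : ℕ, ∀ (F : Type) [Field F] [CharZero F] (v : AbsoluteValue F ℝ), IsNonarchimedean v →
      ∀ (m K : ℕ) (d : Fin K → ℕ) (ε : Fin K → F) (u : Fin K → Fin m → F),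
        ((Matrix.det (∑ l, ((Polynomial.X : Polynomial F) ^ d l) •
            (ε l • Matrix.vecMulVec (u l) (u l)).map Polynomial.C)).support.filter fun E => ∃ r : ℝ, 0 < r ∧
            ∀ E' ∈ (Matrix.det (∑ l, ((Polynomial.X : Polynomial F) ^ d l) •
              (ε l • Matrix.vecMulVec (u l) (u l)).map Polynomial.C)).support, E' ≠ E →
              v ((Matrix.det (∑ l, ((Polynomial.X : Polynomial F) ^ d l) •
                (ε l • Matrix.vecMulVec (u l) (u l)).map Polynomial.C)).coeff E') * r ^ E'
              < v ((Matrix.det (∑ l, ((Polynomial.X : Polynomial F) ^ d l) •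
                (ε l • Matrix.vecMulVec (u l) (u l)).map Polynomial.C)).coeff E) * r ^ E).card - 1
          ≤ (m * K) ^ Cst := by
  rintro ⟨C, hC⟩
  obtain ⟨w, hw, hw2⟩ := twoAdicOnReals_unfolded
  -- (a)+(b): every general (k', K) matrix pencil over (ℝ, w) obeys the budget (2k'·(K·2k'))^C
  have hgen : ∀ (k' K : ℕ) (d : Fin K → ℕ) (M : Fin K → Matrix (Fin k') (Fin k') ℝ),
      ((Matrix.det (∑ l, ((Polynomial.X : Polynomial ℝ) ^ d l) • (M l).map Polynomial.C)).support.filter fun E =>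
          ∃ r : ℝ, 0 < r ∧ ∀ E' ∈ (Matrix.det (∑ l, ((Polynomial.X : Polynomial ℝ) ^ d l) • (M l).map Polynomial.C)).support,
            E' ≠ E →
            w ((Matrix.det (∑ l, ((Polynomial.X : Polynomial ℝ) ^ d l) • (M l).map Polynomial.C)).coeff E') * r ^ E'
              < w ((Matrix.det (∑ l, ((Polynomial.X : Polynomial ℝ) ^ d l) • (M l).map Polynomial.C)).coeff E) * r ^ E).card - 1
        ≤ (2 * k' * (K * (2 * k'))) ^ C := by
    intro k' K d M
    exact symmetryVoid_unfolded k' K ((2 * k' * (K * (2 * k'))) ^ C)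
      (fun F _ _ v hv d S hS => genValRootLaw_of_valRankOneLaw_unfolded C hC F v hv (2 * k') K d S hS) ℝ w hw d M
  -- (d): the DAG, its path polynomial, the pencil
  set m : ℕ := 4 * C + 1 with hm
  set n : ℕ := 8 ^ C * (3 ^ (4 * C + 2) * (4 * C + 2)) ^ (4 * C) + 2 with hn
  obtain ⟨k, G, P, u, hk, hP, hwa, hwb, hlead⟩ := exists_paramDAG_strictLeads_nat n m (by rw [hn]; omega)
  choose a ha using hwa
  choose b hb using hwb
  obtain ⟨K, d, M, hK, hpencil⟩ := exists_pencil_eq_hessNeg G a b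
  have hcount := le_card_dominant_pathPoly G a b ha hb P hP u hlead w hw hw2
  have hbound := hgen k K d M
  rw [← hpencil, det_hessNeg_labels G a b] at hbound
  -- (e): arithmetic
  have harith := budget_lt C k K (by rw [hm, hn] at hk; exact hk) hK
  rw [← hn, ← hm] at harith
  omega

/-- **`ValRankOneSharp` AS TYPED IS FALSE** (it implies `ValRankOneLaw` with `C = 1`: `m (K − m) ≤ m K`). -/
theorem not_valRankOneSharp_unfolded :
    ¬ ∀ (F : Type) [Field F] [CharZero F] (v : AbsoluteValue F ℝ), IsNonarchimedean v →
      ∀ (m K : ℕ) (d : Fin K → ℕ) (ε : Fin K → F) (u : Fin K → Fin m → F),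
        ((Matrix.det (∑ l, ((Polynomial.X : Polynomial F) ^ d l) •
            (ε l • Matrix.vecMulVec (u l) (u l)).map Polynomial.C)).support.filter fun E => ∃ r : ℝ, 0 < r ∧
            ∀ E' ∈ (Matrix.det (∑ l, ((Polynomial.X : Polynomial F) ^ d l) •
              (ε l • Matrix.vecMulVec (u l) (u l)).map Polynomial.C)).support, E' ≠ E →
              v ((Matrix.det (∑ l, ((Polynomial.X : Polynomial F) ^ d l) •
                (ε l • Matrix.vecMulVec (u l) (u l)).map Polynomial.C)).coeff E') * r ^ E'
              < v ((Matrix.det (∑ l, ((Polynomial.X : Polynomial F) ^ d l) •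
                (ε l • Matrix.vecMulVec (u l) (u l)).map Polynomial.C)).coeff E) * r ^ E).card - 1
          ≤ m * (K - m) := by
  intro h
  refine not_valRankOneLaw_unfolded ⟨1, fun F _ _ v hv m K d ε u => (h F v hv m K d ε u).trans ?_⟩
  rw [pow_one]
  exact Nat.mul_le_mul_left m (Nat.sub_le K m)

end Summit.ValiantsHypothesis.ValiantsHypothesis.Theorems.KPlusLogSqLaw.ValDoor
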